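import Summits.KontsevichZagierPeriods.KontsevichZagierPeriods.Theorems.VietaFibreKernelFormStubBoundedDecomposition
import Summits.KontsevichZagierPeriods.KontsevichZagierPeriods.Theorems.VietaFibreKernelFormStubRationalBox
import Summits.KontsevichZagierPeriods.KontsevichZagierPeriods.Theorems.VietaFibreKernelFormCancellerNormalForm
import Summits.KontsevichZagierPeriods.KontsevichZagierPeriods.Theses.VietaFibre
import Literature.NumberTheory.Transcendental.KZCubicalCalculus
import Mathlib.Algebra.Module.CharacterModule
import HarnessLib

/-!
# Crux `KernelForm` (stmt-KontsevichZagierPeriods-10447), line `Sketch`: rigidity of monotone move-invariant functionals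

A *move-invariant functional* of the Kontsevich–Zagier calculus of `KZCalculus.lean` is an additive
map `θ : KZ.FormalRep →+ ℝ` vanishing on `KZ.relations`; it is *monotone* if it is non-negative on
the Viu-Sos normal forms of positive periods, i.e. on the representations `∫_K 1` with `K` compact of
non-empty interior. The crux `KernelForm` (Conjecture 1 of Kontsevich–Zagier in kernel form) says
exactly that EVERY move-invariant functional vanishes on `ker KZ.eval`
(`Literature.Barriers.KontsevichZagierPeriods.moveInvariant_eq_zero_of_kz`), and a move-invariant
functional separating two representations of one number refutes it
(`…not_kz_of_moveInvariant_separating`, the template of route `Neg`, item `NegObstructionShape`).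

**Theorem** (`moveInvariant_eq_mul_eval`, `exists_moveInvariant_eq_mul_eval`). Every monotone
move-invariant functional is a non-negative real multiple of the evaluation:
`θ = θ([0,1]) · KZ.eval`. In particular (`moveInvariant_eq_zero_of_eval_eq_zero`,
`moveInvariant_sub_eq_zero_of_value_eq`) no monotone real-valued invariant of the four move sets
separates two integral representations of the same number, in any dimensions: on the side of the
crux, the thin-canceller statement `UnitPlusSmallCancellation` of this line cannot be proved by an
ordered-group / real-place argument factoring through such a functional; on the side of its
negation (`Neg.CancellationGap`, stmt-11011; `NegObstructionShape`), a refuting invariant with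
values in `ℝ` must change sign on compact volume forms.

Proof (inside the calculus, no transcendence input): by Viu-Sos packing
(`KZ.exists_isCompact_of_sub_of_sub_mem_relations`) `θ` is monotone in the volume on bounded volume
forms of one dimension; rational boxes `b • [0, a/b] × [0,1]^k ≡ a • [0,1]^{k+1}`
(`stub_rationalBox`) pin `θ` on boxes to `(a/b) · θ([0,1]^{k+1})`; the rationals are dense, so
`θ(∫_A 1) = vol(A) · θ([0,1]^{k+1})` for every bounded volume form `A` (squeeze); unit slabs
(`exists_isBounded_lift_of_le`) make `θ([0,1]^{k+1})` independent of `k`; and every formal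
combination is `≡ [A] − [B]` with `A`, `B` bounded volume forms of one dimension
(`stub_boundedDecomposition`). The Archimedean property of `ℝ` is essential: with values in the
lexicographic `ℝ[ε]`, `eval + ε · ψ` is monotone for EVERY move-invariant `ψ`.
-/

noncomputable section

open MeasureTheory Set
open Literature.NumberTheory.Transcendental

namespace Summit.KontsevichZagierPeriods.KernelForm.LocaliseAtValuePrime

/-! ### Move-invariant functionals -/

/-- A move-invariant functional is constant on classes modulo the moves. [folklore] -/
theorem moveInvariant_apply_eq_of_sub_mem {θ : KZ.FormalRep →+ ℝ}
    (h0 : ∀ c ∈ KZ.relations, θ c = 0) {c d : KZ.FormalRep} (h : c - d ∈ KZ.relations) :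
    θ c = θ d := by
  have h' := h0 _ h
  rwa [map_sub, sub_eq_zero] at h'

/-- A move-invariant functional vanishes on the empty representation. [folklore] -/
theorem moveInvariant_of_empty {θ : KZ.FormalRep →+ ℝ} (h0 : ∀ c ∈ KZ.relations, θ c = 0)
    (m : ℕ) : θ (KZ.of (KZ.IntegralRep.empty m)) = 0 :=
  h0 _ KZ.IntegralRep.of_empty_mem_relations

/-- **Monotone move-invariant functionals are monotone in the volume** on bounded volume forms of
one dimension: if `vol B < vol A` then `θ [B] ≤ θ [A]`, because `[A] − [B] ≡ [K]` with `K` compact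
of non-empty interior (Viu-Sos packing inside the rules). [cite: ViuSos2021, §4] [folklore] -/
theorem moveInvariant_mono_of_value_lt {θ : KZ.FormalRep →+ ℝ}
    (h0 : ∀ c ∈ KZ.relations, θ c = 0)
    (hpos : ∀ (m : ℕ) (K : KZ.IntegralRep m), IsCompact K.domain → (interior K.domain).Nonempty →
      (∀ x ∈ K.domain, K.integrand x = 1) → 0 ≤ θ (KZ.of K))
    {m : ℕ} (A B : KZ.IntegralRep m)
    (hA : Bornology.IsBounded A.domain) (hB : Bornology.IsBounded B.domain)
    (hA1 : ∀ x ∈ A.domain, A.integrand x = 1) (hB1 : ∀ x ∈ B.domain, B.integrand x = 1)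
    (hlt : B.value < A.value) : θ (KZ.of B) ≤ θ (KZ.of A) := by
  obtain ⟨K, hKc, hKi, hK1, hrel⟩ :=
    KZ.exists_isCompact_of_sub_of_sub_mem_relations A B hA hB hA1 hB1 hlt
  have h := h0 _ hrel
  rw [map_sub, map_sub] at h
  have hK := hpos m K hKc hKi hK1
  linarith

/-- A monotone move-invariant functional is non-negative on every bounded volume form (compare with
the empty representation when the volume is positive; null domains are relations). [folklore] -/
theorem moveInvariant_nonneg_of_isBounded {θ : KZ.FormalRep →+ ℝ}
    (h0 : ∀ c ∈ KZ.relations, θ c = 0)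
    (hpos : ∀ (m : ℕ) (K : KZ.IntegralRep m), IsCompact K.domain → (interior K.domain).Nonempty →
      (∀ x ∈ K.domain, K.integrand x = 1) → 0 ≤ θ (KZ.of K))
    {m : ℕ} (A : KZ.IntegralRep m) (hA : Bornology.IsBounded A.domain)
    (hA1 : ∀ x ∈ A.domain, A.integrand x = 1) : 0 ≤ θ (KZ.of A) := by
  rcases (show 0 ≤ A.value by
      rw [A.value_eq_volume_real hA1]; exact measureReal_nonneg).eq_or_lt with hv | hv
  · have hvol : volume A.domain = 0 := by
      have h := hv.symm
      rw [A.value_eq_volume_real hA1, measureReal_def,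
        ENNReal.toReal_eq_zero_iff] at h
      exact h.resolve_right hA.measure_lt_top.ne
    rw [h0 _ (KZ.of_mem_relations_of_volume_eq_zero A hvol)]
  · have h := moveInvariant_mono_of_value_lt h0 hpos A (KZ.IntegralRep.empty m) hA
      (by simp) hA1 (by simp) (by simpa using hv)
    rwa [moveInvariant_of_empty h0] at h

/-! ### Rational boxes pin the functional on rational volumes -/

/-- A positive rational is a quotient of two positive naturals (cast to `ℝ`). [folklore] -/
theorem exists_nat_div_eq_of_pos (q : ℚ) (hq : 0 < q) :
    ∃ a b : ℕ, 0 < a ∧ 0 < b ∧ (q : ℝ) = (a : ℝ) / b := by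
  refine ⟨q.num.toNat, q.den, ?_, q.den_pos, ?_⟩
  · have := Rat.num_pos.mpr hq
    omega
  · have hnum : ((q.num.toNat : ℕ) : ℤ) = q.num := Int.toNat_of_nonneg (Rat.num_pos.mpr hq).le
    rw [Rat.cast_def]
    congr 1
    exact_mod_cast hnum.symm

/-- **Rational boxes.** For `0 < a, b` there is a bounded volume form `R = ∫_{[0,a/b]×[0,1]^k} 1` of
value `a/b` with `θ [R] = (a/b) · θ [0,1]^{k+1}` for every move-invariant `θ`
(`b • [R] ≡ a • [0,1]^{k+1}`, `stub_rationalBox`). [folklore] -/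
theorem exists_rationalBox_moveInvariant {θ : KZ.FormalRep →+ ℝ}
    (h0 : ∀ c ∈ KZ.relations, θ c = 0) {k a b : ℕ} (ha : 0 < a) (hb : 0 < b)
    (U : KZ.IntegralRep (k + 1)) (hUd : U.domain = KZ.cube (k + 1))
    (hUi : U.integrand = fun _ => 1) :
    ∃ R : KZ.IntegralRep (k + 1), Bornology.IsBounded R.domain ∧
      (∀ x ∈ R.domain, R.integrand x = 1) ∧ R.value = (a : ℝ) / b ∧
      θ (KZ.of R) = (a : ℝ) / b * θ (KZ.of U) := by
  obtain ⟨R, hRd, hRi⟩ := KZ.exists_oneRep (isSemialgebraic_rationalBoxSet k a b)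
    ((isBounded_rationalBoxSet k a b).measure_lt_top).ne
  have hRU : b • KZ.of R - a • KZ.of U ∈ KZ.relations :=
    stub_rationalBox k a b R U ha hb hRd hRi hUd hUi
  have hUv : U.value = 1 := by
    rw [KZ.IntegralRep.value_eq_volume_real U (fun x _ => by rw [hUi]), hUd, KZ.volume_real_cube]
  have hb' : (b : ℝ) ≠ 0 := by exact_mod_cast hb.ne'
  refine ⟨R, hRd ▸ isBounded_rationalBoxSet k a b, fun x _ => by rw [hRi], ?_, ?_⟩
  · have h := KZ.eval_eq_zero_of_mem_relations hRU
    simp only [map_sub, map_nsmul, KZ.eval_of, hUv, nsmul_eq_mul, mul_one] at h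
    rw [eq_div_iff hb']
    linarith
  · have h := h0 _ hRU
    simp only [map_sub, map_nsmul, nsmul_eq_mul] at h
    rw [div_mul_eq_mul_div, eq_div_iff hb']
    linarith

/-! ### The squeeze: `θ [A] = vol(A) · θ [0,1]^{k+1}` for bounded volume forms -/

/-- **Squeeze.** For a monotone move-invariant functional `θ` and a bounded volume form `A` of
dimension `k + 1`, `θ [A] = θ [0,1]^{k+1} · vol(A)`: rational boxes of volume just below and just
above `vol(A)` bound `θ [A]` on both sides (monotonicity in the volume), and the rationals are dense
in `ℝ` (Archimedes). [folklore] -/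
theorem moveInvariant_of_eq_mul_value {θ : KZ.FormalRep →+ ℝ}
    (h0 : ∀ c ∈ KZ.relations, θ c = 0)
    (hpos : ∀ (m : ℕ) (K : KZ.IntegralRep m), IsCompact K.domain → (interior K.domain).Nonempty →
      (∀ x ∈ K.domain, K.integrand x = 1) → 0 ≤ θ (KZ.of K))
    {k : ℕ} (U : KZ.IntegralRep (k + 1)) (hUd : U.domain = KZ.cube (k + 1))
    (hUi : U.integrand = fun _ => 1)
    (A : KZ.IntegralRep (k + 1)) (hA : Bornology.IsBounded A.domain)
    (hA1 : ∀ x ∈ A.domain, A.integrand x = 1) :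
    θ (KZ.of A) = θ (KZ.of U) * A.value := by
  set l := θ (KZ.of U) with hl
  have hl0 : 0 ≤ l :=
    moveInvariant_nonneg_of_isBounded h0 hpos U (hUd ▸ KZ.isCompact_cube.isBounded)
      (fun x _ => by rw [hUi])
  have hv : 0 ≤ A.value := by rw [A.value_eq_volume_real hA1]; exact measureReal_nonneg
  have hθA : 0 ≤ θ (KZ.of A) := moveInvariant_nonneg_of_isBounded h0 hpos A hA hA1
  -- upper bounds from boxes of volume `q > vol A`
  have hup : ∀ q : ℚ, A.value < q → θ (KZ.of A) ≤ q * l := by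
    intro q hq
    have hq0 : (0 : ℝ) < q := hv.trans_lt hq
    obtain ⟨a, b, ha, hb, hab⟩ := exists_nat_div_eq_of_pos q (by exact_mod_cast hq0)
    obtain ⟨R, hRb, hR1, hRv, hRθ⟩ := exists_rationalBox_moveInvariant h0 ha hb U hUd hUi
    have h := moveInvariant_mono_of_value_lt h0 hpos R A hRb hA hR1 hA1
      (by rw [hRv, ← hab]; exact hq)
    rwa [hRθ, ← hab] at h
  -- lower bounds from boxes of volume `0 < q < vol A`
  have hlow : ∀ q : ℚ, (0 : ℝ) < q → (q : ℝ) < A.value → q * l ≤ θ (KZ.of A) := by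
    intro q hq0 hq
    obtain ⟨a, b, ha, hb, hab⟩ := exists_nat_div_eq_of_pos q (by exact_mod_cast hq0)
    obtain ⟨R, hRb, hR1, hRv, hRθ⟩ := exists_rationalBox_moveInvariant h0 ha hb U hUd hUi
    have h := moveInvariant_mono_of_value_lt h0 hpos A R hA hRb hA1 hR1
      (by rw [hRv, ← hab]; exact hq)
    rwa [hRθ, ← hab] at h
  rcases hl0.eq_or_lt with hl00 | hlpos
  · -- `l = 0`: both sides vanish
    rw [← hl00, zero_mul]
    obtain ⟨q, hq⟩ := exists_rat_gt A.value
    have h := hup q hq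
    rw [← hl00, mul_zero] at h
    exact le_antisymm h hθA
  · apply le_antisymm
    · -- `θ [A] ≤ l · vol A`
      have h : θ (KZ.of A) / l ≤ A.value :=
        le_of_forall_lt_rat_imp_le fun q hq => by
          rw [div_le_iff₀ hlpos]; exact hup q hq
      rwa [div_le_iff₀ hlpos, mul_comm] at h
    · -- `l · vol A ≤ θ [A]`
      have h : A.value ≤ θ (KZ.of A) / l :=
        le_of_forall_rat_lt_imp_le fun q hq => by
          rcases le_or_gt (q : ℝ) 0 with hq0 | hq0
          · exact hq0.trans (div_nonneg hθA hl0)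
          · rw [le_div_iff₀ hlpos]; exact hlow q hq0 hq
      rwa [le_div_iff₀ hlpos, mul_comm] at h

/-- **The constant does not depend on the dimension**: `θ [0,1]^{k+1} = θ [0,1]^{N+1}` (raise the
cube by unit slabs, `exists_isBounded_lift_of_le`, and squeeze in the larger dimension).
[folklore] -/
theorem moveInvariant_of_cube_eq {θ : KZ.FormalRep →+ ℝ}
    (h0 : ∀ c ∈ KZ.relations, θ c = 0)
    (hpos : ∀ (m : ℕ) (K : KZ.IntegralRep m), IsCompact K.domain → (interior K.domain).Nonempty →
      (∀ x ∈ K.domain, K.integrand x = 1) → 0 ≤ θ (KZ.of K))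
    {k N : ℕ} (hkN : k ≤ N) (U : KZ.IntegralRep (k + 1)) (hUd : U.domain = KZ.cube (k + 1))
    (hUi : U.integrand = fun _ => 1) (V : KZ.IntegralRep (N + 1)) (hVd : V.domain = KZ.cube (N + 1))
    (hVi : V.integrand = fun _ => 1) : θ (KZ.of U) = θ (KZ.of V) := by
  obtain ⟨A', hb', h1', e⟩ := exists_isBounded_lift_of_le hkN U
    (hUd ▸ KZ.isCompact_cube.isBounded) (fun z _ => by rw [hUi])
  have hUv : U.value = 1 := by
    rw [KZ.IntegralRep.value_eq_volume_real U (fun x _ => by rw [hUi]), hUd, KZ.volume_real_cube]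
  have hv : A'.value = 1 := by
    have h := KZ.eval_eq_zero_of_mem_relations e
    rw [map_sub, KZ.eval_of, KZ.eval_of, hUv] at h
    linarith
  rw [moveInvariant_apply_eq_of_sub_mem h0 e, moveInvariant_of_eq_mul_value h0 hpos V hVd hVi A' hb' h1',
    hv, mul_one]

/-! ### The rigidity theorem and its corollaries -/

/-- **Rigidity of monotone move-invariant functionals.** Let `θ : KZ.FormalRep →+ ℝ` be additive,
vanish on `KZ.relations`, and be non-negative on every representation `∫_K 1` with `K` compact of
non-empty interior. Then `θ c = θ [0,1] · KZ.eval c` for every formal combination `c`, where `[0,1]`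
is the unit interval with integrand `1` (any representation `U` with `U.domain = KZ.cube 1`,
`U.integrand = 1`). [folklore] -/
theorem moveInvariant_eq_mul_eval {θ : KZ.FormalRep →+ ℝ}
    (h0 : ∀ c ∈ KZ.relations, θ c = 0)
    (hpos : ∀ (m : ℕ) (K : KZ.IntegralRep m), IsCompact K.domain → (interior K.domain).Nonempty →
      (∀ x ∈ K.domain, K.integrand x = 1) → 0 ≤ θ (KZ.of K))
    (U : KZ.IntegralRep 1) (hUd : U.domain = KZ.cube 1) (hUi : U.integrand = fun _ => 1)
    (c : KZ.FormalRep) : θ c = θ (KZ.of U) * KZ.eval c := by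
  obtain ⟨k, A, B, hAb, hBb, hA1, hB1, e⟩ := stub_boundedDecomposition c
  obtain ⟨V, hVd, hVi⟩ := KZ.exists_oneRep (KZ.isSemialgebraic_cube (n := k + 1)) (by simp)
  have he : KZ.eval c = A.value - B.value := by
    have h := KZ.eval_eq_zero_of_mem_relations e
    rw [map_sub, map_sub, KZ.eval_of, KZ.eval_of] at h
    linarith
  rw [moveInvariant_apply_eq_of_sub_mem h0 e, map_sub,
    moveInvariant_of_eq_mul_value h0 hpos V hVd hVi A hAb hA1,
    moveInvariant_of_eq_mul_value h0 hpos V hVd hVi B hBb hB1,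
    ← moveInvariant_of_cube_eq h0 hpos (Nat.zero_le k) U hUd hUi V hVd hVi, he]
  ring

/-- **Rigidity, existential form**: a monotone move-invariant functional is a non-negative real
multiple of the evaluation. [folklore] -/
theorem exists_moveInvariant_eq_mul_eval (θ : KZ.FormalRep →+ ℝ)
    (h0 : ∀ c ∈ KZ.relations, θ c = 0)
    (hpos : ∀ (m : ℕ) (K : KZ.IntegralRep m), IsCompact K.domain → (interior K.domain).Nonempty →
      (∀ x ∈ K.domain, K.integrand x = 1) → 0 ≤ θ (KZ.of K)) :
    ∃ l : ℝ, 0 ≤ l ∧ ∀ c, θ c = l * KZ.eval c := by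
  obtain ⟨U, hUd, hUi⟩ := KZ.exists_oneRep (KZ.isSemialgebraic_cube (n := 1)) (by simp)
  exact ⟨θ (KZ.of U), moveInvariant_nonneg_of_isBounded h0 hpos U
    (hUd ▸ KZ.isCompact_cube.isBounded) (fun x _ => by rw [hUi]),
    moveInvariant_eq_mul_eval h0 hpos U hUd hUi⟩

/-- **Uniqueness of the evaluation**: a monotone move-invariant functional normalised by
`θ [0,1] = 1` IS the evaluation. [folklore] -/
theorem moveInvariant_eq_eval {θ : KZ.FormalRep →+ ℝ}
    (h0 : ∀ c ∈ KZ.relations, θ c = 0)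
    (hpos : ∀ (m : ℕ) (K : KZ.IntegralRep m), IsCompact K.domain → (interior K.domain).Nonempty →
      (∀ x ∈ K.domain, K.integrand x = 1) → 0 ≤ θ (KZ.of K))
    (U : KZ.IntegralRep 1) (hUd : U.domain = KZ.cube 1) (hUi : U.integrand = fun _ => 1)
    (hU : θ (KZ.of U) = 1) : θ = KZ.eval := by
  ext c
  rw [moveInvariant_eq_mul_eval h0 hpos U hUd hUi, hU, one_mul]

/-- **No monotone invariant sees the kernel of the evaluation**: a monotone move-invariant
functional vanishes on every formal combination of value `0` — unconditionally, whereas for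
ARBITRARY move-invariant functionals this is the crux `KernelForm` (Conjecture 1)
(`Literature.Barriers.KontsevichZagierPeriods.moveInvariant_eq_zero_of_kz`). [folklore] -/
theorem moveInvariant_eq_zero_of_eval_eq_zero {θ : KZ.FormalRep →+ ℝ}
    (h0 : ∀ c ∈ KZ.relations, θ c = 0)
    (hpos : ∀ (m : ℕ) (K : KZ.IntegralRep m), IsCompact K.domain → (interior K.domain).Nonempty →
      (∀ x ∈ K.domain, K.integrand x = 1) → 0 ≤ θ (KZ.of K))
    {c : KZ.FormalRep} (hc : KZ.eval c = 0) : θ c = 0 := by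
  obtain ⟨l, -, hl⟩ := exists_moveInvariant_eq_mul_eval θ h0 hpos
  rw [hl, hc, mul_zero]

/-- The same with monotonicity asked on all representations with non-negative integrand (a
stronger hypothesis). [folklore] -/
theorem exists_moveInvariant_eq_mul_eval_of_nonneg (θ : KZ.FormalRep →+ ℝ)
    (h0 : ∀ c ∈ KZ.relations, θ c = 0)
    (hpos : ∀ (m : ℕ) (r : KZ.IntegralRep m), (∀ x ∈ r.domain, 0 ≤ r.integrand x) →
      0 ≤ θ (KZ.of r)) :
    ∃ l : ℝ, 0 ≤ l ∧ ∀ c, θ c = l * KZ.eval c :=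
  exists_moveInvariant_eq_mul_eval θ h0 fun m K _ _ hK1 =>
    hpos m K fun x hx => by rw [hK1 x hx]; exact zero_le_one

/-- **A monotone real-valued invariant of the four move sets is never separating** (the shape of
route `Neg`'s refutation template `NegObstructionShape` / of
`Literature.Barriers.KontsevichZagierPeriods.not_kz_of_moveInvariant_separating`, with `A = ℝ`):
if `ι : KZ.FormalRep →+ ℝ` kills the four move sets and is non-negative on compact volume forms of
non-empty interior, then `ι [r] = ι [r']` whenever `r`, `r'` (of any dimensions) represent the same
number. So a refutation of Conjecture 1 by a real-valued additive invariant needs an invariant that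
changes sign on compact volume forms. [folklore] -/
theorem moveInvariant_sub_eq_zero_of_value_eq (ι : KZ.FormalRep →+ ℝ)
    (hι : ∀ c ∈ KZ.domainAddRel ∪ KZ.integrandAddRel ∪ KZ.changeOfVariablesRel ∪ KZ.newtonLeibnizRel,
      ι c = 0)
    (hpos : ∀ (m : ℕ) (K : KZ.IntegralRep m), IsCompact K.domain → (interior K.domain).Nonempty →
      (∀ x ∈ K.domain, K.integrand x = 1) → 0 ≤ ι (KZ.of K))
    {n m : ℕ} (r : KZ.IntegralRep n) (r' : KZ.IntegralRep m) (hv : r.value = r'.value) :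
    ι (KZ.of r - KZ.of r') = 0 := by
  have h0 : ∀ c ∈ KZ.relations, ι c = 0 := fun c hc =>
    (AddSubgroup.closure_le (K := ι.ker)).mpr hι hc
  exact moveInvariant_eq_zero_of_eval_eq_zero h0 hpos (by rw [map_sub, KZ.eval_of, KZ.eval_of, hv, sub_self])

/-! ### The crux as a statement about all move-invariant functionals -/

/-- **The crux `KernelForm` is exactly blindness of ALL move-invariant functionals on `ker eval`.**
Conjecture 1 in kernel form holds iff every additive `θ : KZ.FormalRep →+ A` (any abelian group `A`)
vanishing on `KZ.relations` vanishes on every formal combination of value `0`. (`→` is soundness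
bookkeeping; `←` takes for `θ` a character `FormalRep → FormalRep ⧸ relations → ℚ/ℤ` not vanishing
on the class of a would-be counterexample — characters of an abelian group separate points.) By
`moveInvariant_eq_zero_of_eval_eq_zero` the MONOTONE real-valued functionals satisfy the right-hand
side unconditionally. [folklore] -/
theorem kernelForm_iff_forall_moveInvariant :
    Summit.KontsevichZagierPeriods.KontsevichZagierPeriods.Theses.VietaFibre.KernelForm ↔
      ∀ (A : Type) [AddCommGroup A] (θ : KZ.FormalRep →+ A),
        (∀ c ∈ KZ.relations, θ c = 0) → ∀ c, KZ.eval c = 0 → θ c = 0 := by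
  unfold Summit.KontsevichZagierPeriods.KontsevichZagierPeriods.Theses.VietaFibre.KernelForm
  constructor
  · intro hK A _ θ h0 c hc
    exact h0 c (hK c hc)
  · intro h c hc
    by_contra hnot
    have hne : (QuotientAddGroup.mk c : KZ.FormalRep ⧸ KZ.relations) ≠ 0 := by
      rwa [Ne, QuotientAddGroup.eq_zero_iff]
    obtain ⟨χ, hχ⟩ := CharacterModule.exists_character_apply_ne_zero_of_ne_zero hne
    set θ : KZ.FormalRep →+ AddCircle (1 : ℚ) :=
      (show (KZ.FormalRep ⧸ KZ.relations) →+ AddCircle (1 : ℚ) from χ).comp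
        (QuotientAddGroup.mk' KZ.relations) with hθ
    have hθ0 : ∀ d ∈ KZ.relations, θ d = 0 := fun d hd => by
      have hd' : (QuotientAddGroup.mk' KZ.relations d) = 0 :=
        (QuotientAddGroup.eq_zero_iff d).mpr hd
      simp only [hθ, AddMonoidHom.coe_comp, Function.comp_apply, hd', map_zero]
    exact hχ (h (AddCircle (1 : ℚ)) θ hθ0 c hc)

/-- **The monotone part of the crux holds**: in the characterisation
`kernelForm_iff_forall_moveInvariant`, every monotone real-valued move-invariant functional already
satisfies the conclusion (restatement of `moveInvariant_eq_zero_of_eval_eq_zero` in that shape).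
[folklore] -/
theorem kernelForm_monotonePart :
    ∀ θ : KZ.FormalRep →+ ℝ, (∀ c ∈ KZ.relations, θ c = 0) →
      (∀ (m : ℕ) (K : KZ.IntegralRep m), IsCompact K.domain → (interior K.domain).Nonempty →
        (∀ x ∈ K.domain, K.integrand x = 1) → 0 ≤ θ (KZ.of K)) →
      ∀ c, KZ.eval c = 0 → θ c = 0 :=
  fun _ h0 hpos _ hc => moveInvariant_eq_zero_of_eval_eq_zero h0 hpos hc

end Summit.KontsevichZagierPeriods.KernelForm.LocaliseAtValuePrime
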